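import Summits.QuantumFields.GaugeBoot.DiagonalRPTorusInnerHalfNegativeHighDim
import Summits.QuantumFields.GaugeBoot.DiagonalRPTorusNegativeUnitary
import HarnessLib

/-!
# Inner-half diagonal RP fails on every even torus `(ℤ/L)^d`, `d ≥ 4`, `L ≥ 4`, for `SU(N)` and
`U(N)` at small coupling (gauge-boot, task L3 sequel, 14/14 — main file)

HONEST FRAMING (cell `pub-gaugeboot`, page 1 of every file): the venture produces certified bounds
on lattice expectations at stated coupling, gauge group, dimension and torus size; NOT a mass gap,
NOT a continuum limit, NOT a string tension; NOT Yang–Mills-summit-bearing (barriers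
`FixedCouplingUltralocality`, `PerturbativeInvisibility`). This module is a structural NEGATIVE
result about which positivity constraints a TORUS certificate may use; it discharges nothing else.

## Content

The tribunal's open cases of the torus diagonal-RP question (t1 A3: "`L = 4` and `d ≥ 4` open")
for the dimension: the tree's negatives `DiagRPSUN.not_innerDiagonalRP_even_suN` /
`not_innerDiagonalRP_even_unitary` are THREE-dimensional (`d = 3`, even `L ≥ 6`, Polyakov-loop
witness, cluster expansion to order `β^{2L}`). Here, for EVERY `d ≥ 4` (four pairwise distinct
directions `i < j < k < l`) and EVERY even `L ≥ 4` (so `L = 4` included):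

* **`not_innerDiagonalRP_even_highDim_of_moments`** — compact metrisable `G`, continuous `ρ`
  (`N ≥ 1`) with a centre element `ρ z₀ = ω • 1`, `ω ≠ 1`, and the single character identity
  (R1) `∫ Re χ(x g⁻¹) Re χ(g y) dg = c₁ Re χ(x y)` with `c₁ > 0`: there is `β₀ > 0` (depending on
  `L, N, d`) with `¬ InnerDiagonalRP (d := d) (L := L) ρ β i j` for all `0 < β ≤ β₀`;
* **`not_innerDiagonalRP_even_highDim_specialUnitary`** (`G ≅ SU(N)`, `N ≥ 2`),
  **`not_innerDiagonalRP_even_highDim_unitary`** (`G ≅ U(N)`, `N ≥ 1`), and the concrete,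
  non-vacuous **`not_innerDiagonalRP_even_suN_highDim`** / **`_uN_highDim`** for
  `Matrix.specialUnitaryGroup (Fin N) ℂ` / `Matrix.unitaryGroup (Fin N) ℂ` on `(ℤ/L)^d`, `d ≥ 4`,
  mirror `x₀ = x₁`; `not_backInvariantDiagonalRP_even_highDim_suN`.

MECHANISM (new, `DiagonalRPTorusHalfAction` … `DiagonalRPTorusInnerHalfNegativeHighDim`): the
witness `F = (Re tr ρ(U_p) - Re tr ρ(U_{p̃})) e^{-β Σ_{q inner} Re tr ρ(U_q)}` with `p, p̃`
TRANSVERSE plaquettes (directions `k, l` — this is where `d ≥ 4` enters) on the top inner layer;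
the factor cancels the Boltzmann weights of the half and of its mirror image, so the small-`β`
expansion runs over the BACK plaquettes only, where the swap acts as a half-period translation:
the only terms of order `≤ β⁸` are the two straight TUBES of eight faces joining `p̃` to `θp`
and `p` to `θp̃` ACROSS THE BACK LAYER, each `= β⁸ c₁⁹ N + O(β⁹)`, entering with a minus sign;
the competing mirror-side tubes (which tie with them at `L = 4` in the plain expansion) are
absent. `β₀ = β₀(L, N, d)` is EXISTENTIAL (crude `2^{#plaquettes}` tail bound), not uniform in `L`.
MEANING (one sentence): for the venture's own gauge groups the finite-torus transplant of inner-half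
diagonal RP fails in every dimension `d ≥ 4` on every even torus at small coupling, as it does in
`d = 3` (`L ≥ 6`); `d = 3`, `L = 4` stays open. Elementary; not in print as far as the cell's
searches go (printed precedent, spin systems, no proof: FILS, J. Stat. Phys. 22 (1980) 297, §3;
Biskup, LNM 1970 (2009) §5.5).
-/

open MeasureTheory Finset Function
open scoped ComplexOrder

namespace Summit.QuantumFields.GaugeBoot

open Literature.MathematicalPhysics.QuantumFieldTheory
open Literature.MathematicalPhysics.QuantumFieldTheory.PlaquetteLowerBound (reTr)
open Literature.RepresentationTheory.CompactGroups

noncomputable section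

namespace DiagRPTube

/-! ## The abstract theorem -/

section Main

variable {d L : ℕ} [NeZero L] {N : ℕ} {G : Type*} [Group G] [TopologicalSpace G]
  [IsTopologicalGroup G] [CompactSpace G] [MeasurableSpace G] [BorelSpace G]
  [SecondCountableTopology G] (ρ : G →* Matrix (Fin N) (Fin N) ℂ)
  {i j k l : Fin d} (hij : i < j) (hjk : j < k) (hkl : k < l)

include hij hjk hkl in
omit [NeZero L] [TopologicalSpace G] [IsTopologicalGroup G] [CompactSpace G] [MeasurableSpace G]
  [BorelSpace G] [SecondCountableTopology G] in
/-- The witness observable is an inner-half observable (`L = 2c`, both squares on the layer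
`c - 1`). -/
theorem isInnerHalfObservable_witness {c : ℕ} (hc : 2 ≤ c) (hL : L = 2 * c) :
    IsInnerHalfObservable i j fun U : GaugeConfig d L G =>
      WilsonRP.plaqRe ρ U (sq k l hkl (baseLow (L := L) i c)) -
        WilsonRP.plaqRe ρ U (sq k l hkl (baseLow' (L := L) i j c)) := by
  have hki : k ≠ i := (ne_of_lt (hij.trans hjk)).symm
  have hkj : k ≠ j := (ne_of_lt hjk).symm
  have hli : l ≠ i := (ne_of_lt (hij.trans (hjk.trans hkl))).symm
  have hlj : l ≠ j := (ne_of_lt (hjk.trans hkl)).symm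
  have hL2 : L / 2 = c := by omega
  have hv : ((c - 1 : ℕ) : ZMod L).val < L / 2 := by rw [hL2]; exact val_cast_lt hL (by omega)
  intro U V hUV
  have key : ∀ y : Site d L, lay i j y = ((c - 1 : ℕ) : ZMod L) →
      WilsonRP.plaqRe ρ U (sq k l hkl y) = WilsonRP.plaqRe ρ V (sq k l hkl y) := by
    intro y hy
    refine plaqRe_congr ρ _ fun a => hUV _ ?_ ?_
    · show (lay i j (link (sq k l hkl y) a).1).val < L / 2
      rw [link_sq, lay_eStart hki hkj hli hlj, hy]; exact hv
    · show (lay i j ((link (sq k l hkl y) a).1.shift (link (sq k l hkl y) a).2)).val < L / 2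
      rw [link_sq]
      show (lay i j (eEnd k l y a)).val < L / 2
      rw [lay_eEnd hij hjk hkl, hy]; exact hv
  simp only [key _ (lay_baseLow hij), key _ (lay_baseLow' hij hc hL)]

include hij hjk hkl in
/-- ★ **Inner-half diagonal RP fails on every even torus `(ℤ/L)^d`, `d ≥ 4`, `L ≥ 4`, at small
coupling, from the character moments.** Let `G` be compact metrisable, `ρ` continuous (`N ≥ 1`)
with a centre element `ρ z₀ = ω • 1`, `ω ≠ 1`, and with the character identity
(R1) `∫ Re χ(x g⁻¹) Re χ(g y) dg = c₁ Re χ(x y)`, `c₁ > 0`. Then for four directions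
`i < j < k < l` and every even `L ≥ 4` there is `β₀ > 0` such that
`¬ InnerDiagonalRP (d := d) (L := L) ρ β i j` for all `0 < β ≤ β₀`. -/
theorem not_innerDiagonalRP_even_highDim_of_moments (hLeven : Even L) (h4 : 4 ≤ L)
    (hρ : Continuous ρ) (hN : 1 ≤ N) {z₀ : G} {ω : ℂ}
    (hz₀ : ρ z₀ = ω • (1 : Matrix (Fin N) (Fin N) ℂ)) (hω : ω ≠ 1) {c₁ : ℝ} (hc₁ : 0 < c₁)
    (hR1 : ∀ x y : G, ∫ g, reTr ρ (x * g⁻¹) * reTr ρ (g * y) ∂haarProbability G =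
      c₁ * reTr ρ (x * y)) :
    ∃ β₀ : ℝ, 0 < β₀ ∧ ∀ β : ℝ, 0 < β → β ≤ β₀ →
      ¬ InnerDiagonalRP (d := d) (L := L) ρ β i j := by
  obtain ⟨c, hcc⟩ := hLeven
  have hL : L = 2 * c := by omega
  have hc : 2 ≤ c := by omega
  have hL2 : L / 2 = c := by omega
  have hNpos : (0 : ℝ) < N := by exact_mod_cast hN
  set C : ℝ := 2 * (N ^ 2 * (2 ^ 8 * N ^ 9)) +
    2 ^ (restPlaqs (L := L) i j c).card * (4 * (N ^ 2 * (2 ^ 9 * N ^ 9))) with hC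
  have hCpos : 0 < C := by positivity
  have hK : 0 < c₁ ^ 9 * N := by positivity
  refine ⟨min (1 / (2 * N)) (c₁ ^ 9 * N / C), lt_min (by positivity) (by positivity),
    fun β hβ hβ0 => ?_⟩
  have hγ : 2 * β * N ≤ 1 := by
    have h := (le_min_iff.1 hβ0).1
    rw [le_div_iff₀ (by positivity)] at h
    linarith
  have hβC : β * C ≤ c₁ ^ 9 * N := by
    have h := (le_min_iff.1 hβ0).2
    rwa [le_div_iff₀ hCpos] at h
  have hneg : trickForm ρ i j (L / 2) β (fun U : GaugeConfig d L G =>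
      WilsonRP.plaqRe ρ U (sq k l hkl (baseLow (L := L) i c)) -
        WilsonRP.plaqRe ρ U (sq k l hkl (baseLow' (L := L) i j c))) < 0 := by
    rw [hL2]
    have h := trickForm_witness_le ρ hij hjk hkl hc hL hρ hz₀ hω hR1 hβ.le hγ
    have h8 : 0 < β ^ 8 := pow_pos hβ 8
    have : -(2 * (β ^ 8 * (c₁ ^ 9 * N))) + β ^ 9 * C = β ^ 8 * (β * C - 2 * (c₁ ^ 9 * N)) := by ring
    rw [this] at h
    nlinarith [mul_pos h8 hK]
  exact not_innerDiagonalRP_of_trickForm_neg ρ hρ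
    (((continuous_plaqRe ρ hρ _).sub (continuous_plaqRe ρ hρ _)))
    (isInnerHalfObservable_witness ρ hij hjk hkl hc hL) hneg

include hij hjk hkl in
/-- ★★ **Inner-half diagonal RP fails on every even torus `(ℤ/L)^d`, `d ≥ 4`, `L ≥ 4`, for
`G ≅ SU(N)` at small coupling** (`IsSpecialUnitaryModel ρ`, `N ≥ 2`; `β₀ = β₀(L, N, d)`). -/
theorem not_innerDiagonalRP_even_highDim_specialUnitary (hρ : IsSpecialUnitaryModel ρ) (hN : 2 ≤ N)
    (hLeven : Even L) (h4 : 4 ≤ L) :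
    ∃ β₀ : ℝ, 0 < β₀ ∧ ∀ β : ℝ, 0 < β → β ≤ β₀ →
      ¬ InnerDiagonalRP (d := d) (L := L) ρ β i j := by
  obtain ⟨z₀, ω, hω, hz₀⟩ := DiagRPSUN.exists_smul_one ρ hρ hN
  obtain ⟨c₁, hc₁, hR1⟩ := DiagRPSUN.exists_re_conv_const ρ hρ hN
  exact not_innerDiagonalRP_even_highDim_of_moments ρ hij hjk hkl hLeven h4 hρ.1 (by omega)
    hz₀ hω hc₁ hR1

include hij hjk hkl in
/-- ★★ **Inner-half diagonal RP fails on every even torus `(ℤ/L)^d`, `d ≥ 4`, `L ≥ 4`, for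
`G ≅ U(N)` at small coupling** (`IsUnitaryModel ρ`, `N ≥ 1`; `β₀ = β₀(L, N, d)`). -/
theorem not_innerDiagonalRP_even_highDim_unitary (hρ : IsUnitaryModel ρ) (hN : 1 ≤ N)
    (hLeven : Even L) (h4 : 4 ≤ L) :
    ∃ β₀ : ℝ, 0 < β₀ ∧ ∀ β : ℝ, 0 < β → β ≤ β₀ →
      ¬ InnerDiagonalRP (d := d) (L := L) ρ β i j := by
  obtain ⟨z₀, ω, hω, hz₀⟩ := DiagRPSUN.exists_smul_one_unitary ρ hρ
  have hNpos : (0 : ℝ) < N := by exact_mod_cast hN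
  exact not_innerDiagonalRP_even_highDim_of_moments ρ hij hjk hkl hLeven h4 hρ.1 hN hz₀ hω
    (c₁ := (2 * N : ℝ)⁻¹) (by positivity) (DiagRPSUN.integral_re_trace_mul_inv_mul_unitary ρ hρ)

include hij hjk hkl in
/-- The back-gauge-invariant closed-half statement fails as well (`G ≅ SU(N)`). -/
theorem not_backInvariantDiagonalRP_even_highDim_specialUnitary (hρ : IsSpecialUnitaryModel ρ)
    (hN : 2 ≤ N) (hLeven : Even L) (h4 : 4 ≤ L) :
    ∃ β₀ : ℝ, 0 < β₀ ∧ ∀ β : ℝ, 0 < β → β ≤ β₀ →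
      ¬ BackInvariantDiagonalRP (d := d) (L := L) ρ β i j := by
  obtain ⟨β₀, hβ₀, h⟩ := not_innerDiagonalRP_even_highDim_specialUnitary ρ hij hjk hkl hρ hN hLeven h4
  exact ⟨β₀, hβ₀, fun β hβ hβ1 hB => h β hβ hβ1 hB.innerDiagonalRP⟩

end Main

/-! ## The concrete groups on `(ℤ/L)^d`, `d ≥ 4`, mirror `x₀ = x₁` -/

section Concrete

open Literature.MathematicalPhysics.QuantumLattice

/-- ★★ **`SU(N)` lattice gauge theory (`N ≥ 2`) violates inner-half diagonal RP on every even
torus `(ℤ/L)^d`, `d ≥ 4`, `L ≥ 4`, for all sufficiently small `β > 0`** (mirror `x₀ = x₁`;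
not vacuous). -/
theorem not_innerDiagonalRP_even_suN_highDim {d L N : ℕ} [NeZero L] (hd : 4 ≤ d) (hN : 2 ≤ N)
    (hLeven : Even L) (h4 : 4 ≤ L) :
    ∃ β₀ : ℝ, 0 < β₀ ∧ ∀ β : ℝ, 0 < β → β ≤ β₀ →
      ¬ InnerDiagonalRP (d := d) (L := L) (fundamentalRep (Fin N)) β ⟨0, by omega⟩ ⟨1, by omega⟩ := by
  haveI : SecondCountableTopology (Matrix (Fin N) (Fin N) ℂ) :=
    inferInstanceAs (SecondCountableTopology (Fin N → Fin N → ℂ))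
  haveI : SecondCountableTopology (Matrix.specialUnitaryGroup (Fin N) ℂ) :=
    Topology.IsEmbedding.subtypeVal.secondCountableTopology
  have h2 : 2 < d := by omega
  have h3 : 3 < d := by omega
  have hij : (⟨0, by omega⟩ : Fin d) < ⟨1, by omega⟩ := Fin.mk_lt_mk.2 (by norm_num)
  have hjk : (⟨1, by omega⟩ : Fin d) < ⟨2, h2⟩ := Fin.mk_lt_mk.2 (by norm_num)
  have hkl : (⟨2, h2⟩ : Fin d) < ⟨3, h3⟩ := Fin.mk_lt_mk.2 (by norm_num)
  exact not_innerDiagonalRP_even_highDim_specialUnitary (fundamentalRep (Fin N)) hij hjk hkl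
    (TorusAreaLaw.isSpecialUnitaryModel_fundamentalRep N) hN hLeven h4

/-- The back-gauge-invariant closed-half statement fails as well for `SU(N)`. -/
theorem not_backInvariantDiagonalRP_even_suN_highDim {d L N : ℕ} [NeZero L] (hd : 4 ≤ d)
    (hN : 2 ≤ N) (hLeven : Even L) (h4 : 4 ≤ L) :
    ∃ β₀ : ℝ, 0 < β₀ ∧ ∀ β : ℝ, 0 < β → β ≤ β₀ →
      ¬ BackInvariantDiagonalRP (d := d) (L := L) (fundamentalRep (Fin N)) β ⟨0, by omega⟩
        ⟨1, by omega⟩ := by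
  obtain ⟨β₀, hβ₀, h⟩ := not_innerDiagonalRP_even_suN_highDim (L := L) hd hN hLeven h4
  exact ⟨β₀, hβ₀, fun β hβ hβ1 hB => h β hβ hβ1 hB.innerDiagonalRP⟩

/-- ★★ **`U(N)` lattice gauge theory (`N ≥ 1`; `N = 1`: compact `U(1)`) violates inner-half
diagonal RP on every even torus `(ℤ/L)^d`, `d ≥ 4`, `L ≥ 4`, for all sufficiently small `β > 0`**
(mirror `x₀ = x₁`; not vacuous). -/
theorem not_innerDiagonalRP_even_uN_highDim {d L N : ℕ} [NeZero L] (hd : 4 ≤ d) (hN : 1 ≤ N)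
    (hLeven : Even L) (h4 : 4 ≤ L) :
    ∃ β₀ : ℝ, 0 < β₀ ∧ ∀ β : ℝ, 0 < β → β ≤ β₀ →
      ¬ InnerDiagonalRP (d := d) (L := L) (unitaryFundamentalRep (Fin N) ℂ) β ⟨0, by omega⟩
        ⟨1, by omega⟩ := by
  haveI : SecondCountableTopology (Matrix.unitaryGroup (Fin N) ℂ) :=
    IsUnitaryModel.secondCountableTopology _ (isUnitaryModel_unitaryFundamentalRep N)
  have h2 : 2 < d := by omega
  have h3 : 3 < d := by omega
  have hij : (⟨0, by omega⟩ : Fin d) < ⟨1, by omega⟩ := Fin.mk_lt_mk.2 (by norm_num)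
  have hjk : (⟨1, by omega⟩ : Fin d) < ⟨2, h2⟩ := Fin.mk_lt_mk.2 (by norm_num)
  have hkl : (⟨2, h2⟩ : Fin d) < ⟨3, h3⟩ := Fin.mk_lt_mk.2 (by norm_num)
  exact not_innerDiagonalRP_even_highDim_unitary (unitaryFundamentalRep (Fin N) ℂ) hij hjk hkl
    (isUnitaryModel_unitaryFundamentalRep N) hN hLeven h4

end Concrete

end DiagRPTube

end

end Summit.QuantumFields.GaugeBoot
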